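import Mathlib
import Literature.NumberTheory.Transcendental.KZCalculus
import Summits.KontsevichZagierPeriods.KontsevichZagierPeriods.Theorems.TorsionLogsNeronTorsionSectorStubBookkeeping
import Summits.KontsevichZagierPeriods.KontsevichZagierPeriods.Theorems.TorsionLogsNeronTorsionSectorStubPeriodSymmetry
import Summits.KontsevichZagierPeriods.KontsevichZagierPeriods.Theorems.TorsionLogsNeronTorsionSectorAssemblyLogClass

/-!
# Crux `TorsionLogs.NeronTorsionSector` (stmt-KontsevichZagierPeriods-14500) — assembly, from moves to logs

Helper for the lead's stub `stub_assembly` (line `registered`): the QUOTIENT BOOKKEEPING. Given, at the level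
of `KZ.FormalRep`, the move-derived relations of the translation chain —
* up-steps `T (j+1) − T j − L(q_{j+1}) + Θ j ∈ relations` (`j + 1 < m`),
* the fold at the `2`-torsion end `C (m−1) − 2•T (m−1) − L(q_m) + Θ (m−1) ∈ relations`,
* the cell recursion `C (j+1) − C j − L(q_{j+1}) + L(q_j) ∈ relations` (`j + 1 < m`),
* the corner step at infinity `2•T 0 − C 0 − L(q_0) + Θlast ∈ relations`,
* additivity of the constant reps `L(a+b) − L a − L b ∈ relations` on real algebraic `a, b`,
* log classes `Θ j − Θ 0` (`1 ≤ j < m`) and `Θ 0 − Θlast`,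
* the cocycle values `q_k` real algebraic, `n`-periodic and symmetric `q_i = q_{n−1−i}`, `n = 2m`, `aa < m`,
  `q(m − aa) = 2pm` —
the target `−q²(Σ_{j∈[aa,m)} T j + Σ (j−aa)•C j) + 2p²m Σ_{j<m} C j` is a log class. Proof: pass to
`V := FormalRep ⧸ relations`, extend `x ↦ [L x]` from the `ℚ`-subspace of real algebraic numbers to an
additive `Lc : ℝ →+ V` through a `ℚ`-linear projection (`Submodule.exists_isCompl`), define the full loop
`t`, `θ`, `Λ` on `V` (rows `j ≥ m` are `C − T` of the mirrored row, `θ_{j} := θ_{n−2−j}`, `θ_{n−1} := Θlast`),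
check the hypotheses of the landed `stub_bookkeeping` (the period coefficient vanishes by the landed
`stub_periodSymmetry`), and read its conclusion back in `FormalRep` with the log-class calculus.
[cite: KontsevichZagier2001, §1.2]
-/

noncomputable section

open Set
open Literature.NumberTheory.Transcendental Literature.NumberTheory.Transcendental.KZ

-- `Summit.KontsevichZagierPeriods.KontsevichZagierPeriods.…` is the tree's mandated layout (single-conjunct summit).
set_option linter.dupNamespace false

namespace Summit.KontsevichZagierPeriods.KontsevichZagierPeriods.Cruxes.NeronTorsionSector.Translation

/-- **Extension of the constant-rep map to an additive map on `ℝ`.** If `L : ℝ → FormalRep` is additive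
modulo `relations` on real algebraic arguments, there is an additive `Lc : ℝ →+ FormalRep ⧸ relations` with
`Lc x = [L x]` for every real algebraic `x` (real algebraic numbers form a `ℚ`-subspace, complemented in `ℝ`).
[folklore] -/
theorem exists_addMonoidHom_extension : ∀ (L : ℝ → Literature.NumberTheory.Transcendental.KZ.FormalRep), (∀ a b : ℝ, IsAlgebraic ℚ a → IsAlgebraic ℚ b → L (a + b) - L a - L b ∈ Literature.NumberTheory.Transcendental.KZ.relations) → ∃ Lc : ℝ →+ Literature.NumberTheory.Transcendental.KZ.FormalRep ⧸ Literature.NumberTheory.Transcendental.KZ.relations, ∀ x : ℝ, IsAlgebraic ℚ x → Lc x = QuotientAddGroup.mk' Literature.NumberTheory.Transcendental.KZ.relations (L x) := by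
  intro L hLadd
  set W : Submodule ℚ ℝ := Subalgebra.toSubmodule (integralClosure ℚ ℝ) with hW
  have hmemW : ∀ {x : ℝ}, x ∈ W ↔ IsAlgebraic ℚ x := by
    intro x
    rw [hW, Subalgebra.mem_toSubmodule, mem_integralClosure_iff, isAlgebraic_iff_isIntegral]
  have hL0 : L 0 ∈ relations := by
    have h := hLadd 0 0 isAlgebraic_zero isAlgebraic_zero
    rw [add_zero, sub_self, zero_sub] at h
    simpa using relations.neg_mem h
  -- the additive map on `W`
  let φ : W →+ FormalRep ⧸ relations :=
    { toFun := fun w => QuotientAddGroup.mk' relations (L w)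
      map_zero' := by
        change QuotientAddGroup.mk' relations (L 0) = 0
        exact (QuotientAddGroup.eq_zero_iff _).mpr hL0
      map_add' := by
        intro a b
        change QuotientAddGroup.mk' relations (L ((a : ℝ) + b)) =
          QuotientAddGroup.mk' relations (L a) + QuotientAddGroup.mk' relations (L b)
        rw [← map_add, ← sub_eq_zero, ← map_sub]
        have h := hLadd a b (hmemW.mp a.2) (hmemW.mp b.2)
        have e : L ((a : ℝ) + b) - (L a + L b) = L ((a : ℝ) + b) - L a - L b := by abel
        rw [e]
        exact (QuotientAddGroup.eq_zero_iff _).mpr h }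
  obtain ⟨W', hWW'⟩ := W.exists_isCompl
  let π : ℝ →ₗ[ℚ] W := Submodule.projectionOnto W W' hWW'
  refine ⟨φ.comp π.toAddMonoidHom, fun x hx => ?_⟩
  have hxW : x ∈ W := hmemW.mpr hx
  change φ (π x) = _
  have : π x = ⟨x, hxW⟩ := Submodule.projectionOnto_apply_left hWW' ⟨x, hxW⟩
  rw [this]
  rfl

/-- **From the move relations of the translation chain to a log class** (quotient bookkeeping; see the
module docstring). The `Prop` "`F` is a log class of value `v`" is spelled out as the explicit `∃`-block of
interval log carriers (the output shape of `stub_dlogUnfold` / `stub_logStep`). [cite: KontsevichZagier2001, §1.2] -/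
theorem chain_to_logClass (n m aa : ℕ) (p q : ℤ) (hn : n = 2 * m) (haa : aa < m)
    (hpq : q * ((m : ℤ) - (aa : ℤ)) = 2 * p * (m : ℤ))
    (qv : ℕ → ℝ) (hper : ∀ k, qv (k + n) = qv k) (hsym : ∀ i, i < n → qv i = qv (n - 1 - i))
    (hqalg : ∀ k, IsAlgebraic ℚ (qv k))
    (T C Θ : ℕ → FormalRep) (Θlast : FormalRep) (L : ℝ → FormalRep)
    (hLadd : ∀ a b : ℝ, IsAlgebraic ℚ a → IsAlgebraic ℚ b → L (a + b) - L a - L b ∈ relations)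
    (hT : ∀ j, j + 1 < m → T (j + 1) - T j - L (qv (j + 1)) + Θ j ∈ relations)
    (hF : C (m - 1) - 2 • T (m - 1) - L (qv m) + Θ (m - 1) ∈ relations)
    (hCr : ∀ j, j + 1 < m → C (j + 1) - C j - L (qv (j + 1)) + L (qv j) ∈ relations)
    (hW : 2 • T 0 - C 0 - L (qv 0) + Θlast ∈ relations)
    (hΘ : ∀ j, 1 ≤ j → j < m → ∃ (v : ℝ) (κ : ℕ) (α β : Fin κ → ℝ) (ε : Fin κ → ℤ)
      (cs : Fin κ → IntegralRep 1),
      (∀ i, 0 < α i ∧ α i ≤ β i ∧ IsAlgebraic ℚ (α i) ∧ IsAlgebraic ℚ (β i) ∧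
        (cs i).domain = {t | α i < t 0 ∧ t 0 < β i} ∧
        Set.EqOn (cs i).integrand (fun t => 1 / t 0) (cs i).domain) ∧
      ∑ i, (ε i : ℝ) * Real.log (β i / α i) = v ∧ (Θ j - Θ 0) - ∑ i, ε i • of (cs i) ∈ relations)
    (hB : ∃ (v : ℝ) (κ : ℕ) (α β : Fin κ → ℝ) (ε : Fin κ → ℤ) (cs : Fin κ → IntegralRep 1),
      (∀ i, 0 < α i ∧ α i ≤ β i ∧ IsAlgebraic ℚ (α i) ∧ IsAlgebraic ℚ (β i) ∧
        (cs i).domain = {t | α i < t 0 ∧ t 0 < β i} ∧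
        Set.EqOn (cs i).integrand (fun t => 1 / t 0) (cs i).domain) ∧
      ∑ i, (ε i : ℝ) * Real.log (β i / α i) = v ∧ (Θ 0 - Θlast) - ∑ i, ε i • of (cs i) ∈ relations) :
    ∃ (v : ℝ) (κ : ℕ) (α β : Fin κ → ℝ) (ε : Fin κ → ℤ) (cs : Fin κ → IntegralRep 1),
      (∀ i, 0 < α i ∧ α i ≤ β i ∧ IsAlgebraic ℚ (α i) ∧ IsAlgebraic ℚ (β i) ∧
        (cs i).domain = {t | α i < t 0 ∧ t 0 < β i} ∧
        Set.EqOn (cs i).integrand (fun t => 1 / t 0) (cs i).domain) ∧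
      ∑ i, (ε i : ℝ) * Real.log (β i / α i) = v ∧
      (-(q ^ 2) • (∑ j ∈ Finset.Ico aa m, T j + ∑ j ∈ Finset.Ico aa m, ((j : ℤ) - (aa : ℤ)) • C j)
        + (2 * p ^ 2 * (m : ℤ)) • ∑ j ∈ Finset.range m, C j) - ∑ i, ε i • of (cs i) ∈ relations := by
  classical
  -- basic index facts
  have hm0 : 0 < m := lt_of_le_of_lt (Nat.zero_le _) haa
  have hn1 : 1 < n := by omega
  -- the quotient and the extension of `L`
  set mk : FormalRep →+ FormalRep ⧸ relations := QuotientAddGroup.mk' relations with hmk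
  have hmk0 : ∀ {x : FormalRep}, mk x = 0 ↔ x ∈ relations := fun {x} => by
    rw [hmk]; exact QuotientAddGroup.eq_zero_iff x
  have hmkeq : ∀ {x y : FormalRep}, mk x = mk y ↔ x - y ∈ relations := fun {x y} => by
    rw [← sub_eq_zero, ← map_sub, hmk0]
  obtain ⟨Lc, hLc⟩ := exists_addMonoidHom_extension L hLadd
  have hLq : ∀ k, Lc (qv k) = mk (L (qv k)) := fun k => by rw [hLc _ (hqalg k), hmk]
  -- the full loop on the quotient
  let t : ℕ → FormalRep ⧸ relations := fun j =>
    if j < m then mk (T j) else if j < n then mk (C (n - 1 - j)) - mk (T (n - 1 - j)) else mk (T 0)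
  let c : ℕ → FormalRep ⧸ relations := fun j => mk (C j)
  -- representatives of the θ's and the Λ's
  let ΘF : ℕ → FormalRep := fun j => if j < m then Θ j else if j + 1 < n then Θ (n - 2 - j) else Θlast
  let θ : ℕ → FormalRep ⧸ relations := fun j => mk (ΘF j)
  let Λ : ℕ → FormalRep ⧸ relations := fun j => θ j - θ 0
  -- unfolding lemmas
  have ht_lo : ∀ j, j < m → t j = mk (T j) := fun j hj => by simp [t, hj]
  have ht_hi : ∀ j, m ≤ j → j < n → t j = mk (C (n - 1 - j)) - mk (T (n - 1 - j)) := fun j hj hjn => by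
    simp [t, not_lt.mpr hj, hjn]
  have ht_n : t n = mk (T 0) := by simp [t, show ¬ n < m by omega]
  have ht_0 : t 0 = mk (T 0) := ht_lo 0 hm0
  have hθ_lo : ∀ j, j < m → θ j = mk (Θ j) := fun j hj => by simp [θ, ΘF, hj]
  have hθ_hi : ∀ j, m ≤ j → j + 1 < n → θ j = mk (Θ (n - 2 - j)) := fun j hj hjn => by
    simp [θ, ΘF, not_lt.mpr hj, hjn]
  have hθ_last : θ (n - 1) = mk Θlast := by
    simp [θ, ΘF, show ¬ n - 1 < m by omega, show ¬ n - 1 + 1 < n by omega]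
  have hθ_0 : θ 0 = mk (Θ 0) := hθ_lo 0 hm0
  -- hypotheses of `stub_bookkeeping`
  have Ht : ∀ j, j < n → t (j + 1) = t j + Lc (qv (j + 1)) - θ j := by
    intro j hj
    rcases lt_trichotomy (j + 1) m with h1 | h1 | h1
    · -- regular up-step
      rw [ht_lo (j + 1) h1, ht_lo j (by omega), hθ_lo j (by omega), hLq,
        ← sub_eq_zero]
      have e : mk (T (j + 1)) - (mk (T j) + mk (L (qv (j + 1))) - mk (Θ j)) =
          mk (T (j + 1) - T j - L (qv (j + 1)) + Θ j) := by simp only [map_sub, map_add]; abel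
      rw [e, hmk0]
      exact hT j h1
    · -- the fold: `j = m - 1`
      have hj' : j = m - 1 := by omega
      subst hj'
      rw [ht_hi (m - 1 + 1) (by omega) (by omega), ht_lo (m - 1) (by omega), hθ_lo (m - 1) (by omega), hLq]
      have e1 : n - 1 - (m - 1 + 1) = m - 1 := by omega
      rw [e1, h1, ← sub_eq_zero]
      have e : mk (C (m - 1)) - mk (T (m - 1)) - (mk (T (m - 1)) + mk (L (qv m)) - mk (Θ (m - 1))) =
          mk (C (m - 1) - 2 • T (m - 1) - L (qv m) + Θ (m - 1)) := by
        simp only [map_sub, map_add, map_nsmul]; abel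
      rw [e, hmk0]
      exact hF
    · rcases lt_or_ge (j + 1) n with h2 | h2
      · -- a down-step: algebraic consequence of an up-step and two cells
        have hk1 : n - 1 - (j + 1) + 1 = n - 1 - j := by omega
        have hjm : m ≤ j := by omega
        rw [ht_hi (j + 1) (by omega) h2, ht_hi j hjm hj, hθ_hi j hjm h2, hLq]
        set k := n - 1 - (j + 1) with hk
        have hkm : k + 1 < m := by omega
        have e2 : n - 1 - j = k + 1 := by omega
        have e3 : n - 2 - j = k := by omega
        have e4 : qv (j + 1) = qv k := by
          rw [hsym (j + 1) h2]
        rw [e2, e3, e4, ← sub_eq_zero]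
        have e : mk (C k) - mk (T k) - (mk (C (k + 1)) - mk (T (k + 1)) + mk (L (qv k)) - mk (Θ k)) =
            mk ((T (k + 1) - T k - L (qv (k + 1)) + Θ k) - (C (k + 1) - C k - L (qv (k + 1)) + L (qv k))) := by
          simp only [map_sub, map_add]; abel
        rw [e, hmk0]
        exact relations.sub_mem (hT k hkm) (hCr k hkm)
      · -- the corner step at infinity: `j = n - 1`
        have hj' : j = n - 1 := by omega
        subst hj'
        have e1 : n - 1 + 1 = n := by omega
        rw [e1, ht_n, ht_hi (n - 1) (by omega) (by omega), hθ_last, hLq]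
        have e2 : n - 1 - (n - 1) = 0 := by omega
        have e3 : qv n = qv 0 := by simpa using hper 0
        rw [e2, e3, ← sub_eq_zero]
        have e : mk (T 0) - (mk (C 0) - mk (T 0) + mk (L (qv 0)) - mk Θlast) =
            mk (2 • T 0 - C 0 - L (qv 0) + Θlast) := by
          simp only [map_sub, map_add, map_nsmul]; abel
        rw [e, hmk0]
        exact hW
  have Hc : ∀ j, j + 1 < m → c (j + 1) = c j + Lc (qv (j + 1) - qv j) := by
    intro j hj
    rw [map_sub, hLq, hLq, ← sub_eq_zero]
    have e : mk (C (j + 1)) - (mk (C j) + (mk (L (qv (j + 1))) - mk (L (qv j)))) =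
        mk (C (j + 1) - C j - L (qv (j + 1)) + L (qv j)) := by simp only [map_sub, map_add]; abel
    change mk (C (j + 1)) - (mk (C j) + (mk (L (qv (j + 1))) - mk (L (qv j)))) = 0
    rw [e, hmk0]
    exact hCr j hj
  have Hw : t n = t 0 := by rw [ht_n, ht_0]
  have Hrefl : c 0 = t 0 + t (n - 1) := by
    change mk (C 0) = t 0 + t (n - 1)
    rw [ht_0, ht_hi (n - 1) (by omega) (by omega)]
    have e2 : n - 1 - (n - 1) = 0 := by omega
    rw [e2]; abel
  have HΛ : ∀ j, j < n → θ j = θ 0 + Λ j := fun j _ => by simp [Λ]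
  have HC : -(q ^ 2) • ∑ j ∈ Finset.Ico aa m, ∑ i ∈ Finset.range j, qv (i + 1)
        - (q ^ 2) • ∑ j ∈ Finset.Ico aa m, ((j : ℤ) - (aa : ℤ)) • (qv j - qv 0)
        + (2 * p ^ 2 * (m : ℤ)) • ∑ j ∈ Finset.range m, (qv j - qv 0)
        + (p * q * (m : ℤ)) • ∑ i ∈ Finset.range (n - 1), qv (i + 1)
        - (p ^ 2 * (m : ℤ)) • ∑ i ∈ Finset.range n, qv (i + 1) = 0 := by
    have h := stub_periodSymmetry n m aa p q qv hn haa (by exact_mod_cast hpq) hper hsym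
    simp only [zsmul_eq_mul]
    push_cast
    linear_combination h
  -- the landed bookkeeping, on `V = FormalRep ⧸ relations` with `K = ℝ`
  have key := stub_bookkeeping n m aa p q hn haa hpq t c θ Λ Lc qv Ht Hc Hw Hrefl HΛ HC
  -- read the conclusion back in `FormalRep`
  set X : FormalRep := -(q ^ 2) • (∑ j ∈ Finset.Ico aa m, T j + ∑ j ∈ Finset.Ico aa m,
      ((j : ℤ) - (aa : ℤ)) • C j) + (2 * p ^ 2 * (m : ℤ)) • ∑ j ∈ Finset.range m, C j with hX
  let ΛF : ℕ → FormalRep := fun j => ΘF j - Θ 0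
  set Y : FormalRep := (q ^ 2) • ∑ j ∈ Finset.Ico aa m, ∑ i ∈ Finset.range j, ΛF i
      - (p * q * (m : ℤ)) • ∑ j ∈ Finset.range (n - 1), ΛF j
      + (p ^ 2 * (m : ℤ)) • ∑ j ∈ Finset.range n, ΛF j with hY
  have hmkX : mk X = -(q ^ 2) • (∑ j ∈ Finset.Ico aa m, t j + ∑ j ∈ Finset.Ico aa m,
      ((j : ℤ) - (aa : ℤ)) • c j) + (2 * p ^ 2 * (m : ℤ)) • ∑ j ∈ Finset.range m, c j := by
    rw [hX]
    simp only [map_add, map_zsmul, map_sum]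
    congr 2
    · congr 1
      exact Finset.sum_congr rfl fun j hj => (ht_lo j (Finset.mem_Ico.mp hj).2).symm
  have hmkΛ : ∀ j, mk (ΛF j) = Λ j := fun j => by simp [ΛF, Λ, θ, hθ_0]
  have hmkY : mk Y = (q ^ 2) • ∑ j ∈ Finset.Ico aa m, ∑ i ∈ Finset.range j, Λ i
      - (p * q * (m : ℤ)) • ∑ j ∈ Finset.range (n - 1), Λ j
      + (p ^ 2 * (m : ℤ)) • ∑ j ∈ Finset.range n, Λ j := by
    rw [hY]
    simp only [map_add, map_sub, map_zsmul, map_sum, hmkΛ]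
  have hXY : X - Y ∈ relations := by
    rw [← hmkeq, hmkX, hmkY]
    exact key
  -- every `ΛF j` is a log class
  have hΛF : ∀ j, ∃ (v : ℝ) (κ : ℕ) (α β : Fin κ → ℝ) (ε : Fin κ → ℤ) (cs : Fin κ → IntegralRep 1),
      (∀ i, 0 < α i ∧ α i ≤ β i ∧ IsAlgebraic ℚ (α i) ∧ IsAlgebraic ℚ (β i) ∧
        (cs i).domain = {t | α i < t 0 ∧ t 0 < β i} ∧
        Set.EqOn (cs i).integrand (fun t => 1 / t 0) (cs i).domain) ∧
      ∑ i, (ε i : ℝ) * Real.log (β i / α i) = v ∧ ΛF j - ∑ i, ε i • of (cs i) ∈ relations := by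
    intro j
    -- the lower θ's, possibly the zero class
    have lower : ∀ k, k < m → ∃ (v : ℝ) (κ : ℕ) (α β : Fin κ → ℝ) (ε : Fin κ → ℤ)
        (cs : Fin κ → IntegralRep 1),
        (∀ i, 0 < α i ∧ α i ≤ β i ∧ IsAlgebraic ℚ (α i) ∧ IsAlgebraic ℚ (β i) ∧
          (cs i).domain = {t | α i < t 0 ∧ t 0 < β i} ∧
          Set.EqOn (cs i).integrand (fun t => 1 / t 0) (cs i).domain) ∧
        ∑ i, (ε i : ℝ) * Real.log (β i / α i) = v ∧ (Θ k - Θ 0) - ∑ i, ε i • of (cs i) ∈ relations := by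
      intro k hk
      rcases Nat.eq_zero_or_pos k with rfl | hk0
      · refine ⟨0, ?_⟩
        simpa using logClass_zero
      · exact hΘ k hk0 hk
    by_cases hj : j < m
    · simpa [ΛF, ΘF, hj] using lower j hj
    · by_cases hj2 : j + 1 < n
      · have h := lower (n - 2 - j) (by omega)
        simpa [ΛF, ΘF, hj, hj2] using h
      · obtain ⟨v, hv⟩ := hB
        refine ⟨-v, ?_⟩
        have h := logClass_neg hv
        have e : -(Θ 0 - Θlast) = ΛF j := by simp [ΛF, ΘF, hj, hj2]
        rw [e] at h
        exact h
  choose vΛ hvΛ using hΛF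
  -- `Y` is a log class
  have hY1 := logClass_sum_zsmul (Finset.Ico aa m) (fun _ => q ^ 2)
    (fun j => ∑ i ∈ Finset.range j, ΛF i) (fun j => ∑ i ∈ Finset.range j, vΛ i)
    (fun j _ => logClass_sum (Finset.range j) ΛF vΛ fun i _ => hvΛ i)
  have hY2 := logClass_sum_zsmul (Finset.range (n - 1)) (fun _ => p * q * (m : ℤ)) ΛF vΛ
    (fun j _ => hvΛ j)
  have hY3 := logClass_sum_zsmul (Finset.range n) (fun _ => p ^ 2 * (m : ℤ)) ΛF vΛ (fun j _ => hvΛ j)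
  have hYcl := logClass_add (logClass_add hY1 (logClass_neg hY2)) hY3
  have eY : (∑ j ∈ Finset.Ico aa m, q ^ 2 • ∑ i ∈ Finset.range j, ΛF i +
      -∑ j ∈ Finset.range (n - 1), (p * q * (m : ℤ)) • ΛF j) +
      ∑ j ∈ Finset.range n, (p ^ 2 * (m : ℤ)) • ΛF j = Y := by
    rw [hY, ← Finset.smul_sum, ← Finset.smul_sum, ← Finset.smul_sum]
    abel
  rw [eY] at hYcl
  obtain ⟨κ, α, β, ε, cs, hcs, hsum, hrel⟩ := logClass_congr (F := Y) (F' := X)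
    (by
      have e : Y - X = -(X - Y) := by abel
      rw [e]
      exact relations.neg_mem hXY) hYcl
  exact ⟨_, κ, α, β, ε, cs, hcs, hsum, hrel⟩

end Summit.KontsevichZagierPeriods.KontsevichZagierPeriods.Cruxes.NeronTorsionSector.Translation
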